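import Summits.BirchSwinnertonDyer.Rank1Residual.GaloisImage.PrimeChoiceSakamotoTorsion
import Summits.BirchSwinnertonDyer.Rank1Residual.GaloisImage.KolyvaginSystemsCoreRankZero
import Summits.BirchSwinnertonDyer.Rank1Residual.X11b.WeilTransport
import HarnessLib

/-!
# Sakamoto's prime choice with a DUAL class: [MR04] Prop. 3.6.1 at `p = 3` in the tree's
# `tateDual` currency (cell `b2b-bsdres`, team n1011, seat p15 GEN 3; appendix (α) of row T-C55K for
# the programme "S24(1)@m=1 in the kernel" (n1011-p13 / p11, INBOX 2026-08-21 14:45Z): the input of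
# [MR04] Lemma 4.1.9 (core vertices) and Prop. 4.3.10 / Thm. 4.3.12 (connectedness of `𝒳⁰`))

HONEST FRAMING (cell `b2b-bsdres`, run/shared/lean/b2b/bsd-rank1-residual/, verbatim in every
file): the goal of the cell is to DELETE the COMBINATION-SHAPED residual classes of the
Birch–Swinnerton-Dyer formula for ALL analytic-rank `≤ 1` elliptic curves over `ℚ` — "full BSD
formula for every rank `≤ 1` curve in class `C`" assembled STRICTLY from published theorems — so
that the rank-`≤ 1` remainder becomes exactly the CONSTRUCTION-SHAPED classes, which are TYPED
(missing-input `Prop`s), NOT attempted. This is not "finishing BSD". Team n1011 (N10 / N11, the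
additive block X4 ∧ `p = 3`): research route; TOOL theorems of Galois cohomology (no class theorem,
nothing booked, no mark / label moved); theorems only — no definition, no named fact, no `sorry`.

## What and why

Mazur–Rubin's prime-choice lemma [MR04] Prop. 3.6.1 reads: for `c ∈ H¹(K, T̄)` and `c* ∈ H¹(K, T̄*)`
both non-zero there is a positive-density set of primes `𝔮 ∈ 𝒫` with `loc_𝔮 c ≠ 0` AND
`loc_𝔮 c* ≠ 0`; its proof needs (H.4) (`T̄ ≇ T̄*` or `p > 4`), which FAILS for elliptic curves at
`p = 3`.  Sakamoto's replacement (JTNB 36 (2024) Lemma 5.2 / Cor. 5.5) is a kernel theorem of row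
T-C55K for up to `p` classes of ONE module (`PrimeChoice.infinite_setOf_mem_frobeniusClassPrimes_forall_localization_ne_zero`,
p271663).  This appendix states the MIXED form the Mazur–Rubin graph arguments (§4.1 Lemma 4.1.9,
§4.3 Prop. 4.3.10 / Thm. 4.3.12) actually invoke — some classes in `H¹(K, T̄)`, some in `H¹(K, T̄′)`
for a second module `T̄′` mapping equivariantly to `T̄` with `H¹`-injective transport (for `T̄ = E[p]`:
`T̄′ = E[p]^∨(1)` along the inverse Weil transport `X11b.LocBridge.weilDualInv`, injective on `H¹`
by `map_weilDual_map_weilDualInv`) — by transporting the `T̄′`-classes to `H¹(K, T̄)` and reading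
`loc_𝔮` back through the naturality square (`galoisCohomology.res_map_one`), exactly the three-line
step inside n1011-p11's `CoreRankZero.kolyvaginSystems_eq_bot_of_hasCoreRank_zero_of_selfDual`, now
as named statements:

* `infinite_setOf_mem_frobeniusClassPrimes_localization_ne_zero_mixed` — generic: `n` classes of
  `H¹(K, T̄)` and `n′` classes of `H¹(K, T̄′)`, `n + n′ ≤ p`, all non-zero ⟹ infinitely many
  `𝔮 ∈ frobeniusClassPrimes ρ S τ N` with every `loc_𝔮 ≠ 0`;
* `infinite_setOf_mem_frobeniusClassPrimes_localization_ne_zero_dual` — one class and one dual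
  class (the literal shape of [MR04] Prop. 3.6.1; `1 + 1 ≤ p` for every prime);
* `infinite_setOf_mem_frobeniusClassPrimes_localization_ne_zero_torsion_dual` /
  `…_torsion_mixed` — the `E[p]` reading over `ℚ`, `p` odd, `ρ̄_{E,p}` onto: for non-zero
  `c ∈ H¹(ℚ, E[p])`, `c* ∈ H¹(ℚ, E[p]^D)` (resp. `c₁, c₂` and `c*`), infinitely many
  `𝔮 ∈ frobeniusClassPrimes (E[p]) S τ p` with `loc_𝔮 c ≠ 0 ∧ loc_𝔮 c* ≠ 0`.

References: B. Mazur, K. Rubin, Mem. AMS **799** (2004) Prop. 3.6.1 (pp. 30–31), Lemma 4.1.9,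
Prop. 4.3.10, Thm. 4.3.12 [MazurRubin2004]; R. Sakamoto, JTNB **36** (2024) Lemma 5.2, Cor. 5.5
(pp. 928–930) [Sakamoto2024]; J. S. Milne, *ADT* I §6 [MilneADT2006].
-/

noncomputable section

open scoped Classical NumberField ContRepresentation
open Function Field NumberField IsDedekindDomain WeierstrassCurve
open Literature.NumberTheory.EllipticCurves
open Literature.NumberTheory.GaloisRepresentations Literature.NumberTheory.GaloisRepresentations.DiscreteGaloisModule
open Literature.NumberTheory.GaloisCohomology
open Summit.BirchSwinnertonDyer.Rank1Residual.X11b.LocBridge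

namespace Summit.BirchSwinnertonDyer.Rank1Residual.GaloisImage.PrimeChoice

/-! ### Generic: classes in two modules with an `H¹`-injective equivariant transport -/

section Generic

variable {K : Type} [Field K] [NumberField K]
variable {M : Type} [AddCommGroup M] [TopologicalSpace M] [DiscreteTopology M] [Finite M]
variable {M' : Type} [AddCommGroup M'] [TopologicalSpace M'] [DiscreteTopology M']
variable (ρ : DiscreteGaloisModule K M) {ρ' : DiscreteGaloisModule K M'}

/-- **Prime choice for classes in two modules** ([MR04] Prop. 3.6.1's shape, Sakamoto's proof): for a
finite `Γ_K`-module `T̄` with (H.1), (H.3) (tree shapes) and `τ` with `T̄/(τ − 1)T̄ ≃ ℤ/p`, a second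
module `T̄′` with an equivariant `θ′ : T̄′ → T̄` INJECTIVE on `H¹(K, ·)`, and non-zero classes
`c₁ … cₙ ∈ H¹(K, T̄)`, `c′₁ … c′ₙ′ ∈ H¹(K, T̄′)` with `n + n′ ≤ p`: infinitely many
`𝔮 ∈ frobeniusClassPrimes ρ S τ N` have `loc_𝔮 cᵢ ≠ 0` for all `i` AND `loc_𝔮 c′ⱼ ≠ 0` for all `j`
(transport the `c′ⱼ` by `H¹(θ′)`, apply the one-module theorem of row T-C55K to the `n + n′` classes,
read `loc_𝔮` back through naturality `loc_𝔮 ∘ H¹(θ′) = H¹(θ′_𝔮) ∘ loc_𝔮`).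
[cite: MazurRubin2004, Prop. 3.6.1 (pp. 30–31)] [cite: Sakamoto2024, Lemma 5.2 and Cor. 5.5 (pp. 928–930)] -/
theorem infinite_setOf_mem_frobeniusClassPrimes_localization_ne_zero_mixed
    {p : ℕ} [Fact p.Prime] {N : ℕ} (hN : N ≠ 0)
    (S : Set (HeightOneSpectrum (𝓞 K))) (hS : S.Finite)
    {τ : absoluteGaloisGroup K} (hτ : Nonempty (cokerSubOne ρ τ ≃+ ZMod p))
    (hirr : ∀ A : AddSubgroup M,
      (∀ (s : absoluteGaloisGroup K), ∀ m ∈ A, ρ s m ∈ A) → A = ⊥ ∨ A = ⊤)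
    (hH3 : ∀ f : contOneCocycles ρ.toTopRep,
      (∀ u : absoluteGaloisGroup K, ρ u = 1 → u ∈ rootsOfUnityFixer K N → f.1 u = 0) →
        oneCocycleClass ρ.toTopRep f = 0)
    (θ' : ρ'.toContRepresentation →ⁱL ρ.toContRepresentation)
    (hθ' : Injective (galoisCohomology.map θ' 1))
    {n n' : ℕ} (hn : n + n' ≤ p)
    (c : Fin n → galoisCohomology ρ 1) (hc : ∀ i, c i ≠ 0)
    (c' : Fin n' → galoisCohomology ρ' 1) (hc' : ∀ j, c' j ≠ 0) :
    {q | q ∈ frobeniusClassPrimes ρ S τ N ∧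
      (∀ i, galoisCohomology.localization ρ (Sum.inr q) 1 (c i) ≠ 0) ∧
      ∀ j, galoisCohomology.localization ρ' (Sum.inr q) 1 (c' j) ≠ 0}.Infinite := by
  -- the `n + n′` classes of `H¹(K, T̄)`: `c` followed by the transported `H¹(θ′) c′`
  let d : Fin (n + n') → galoisCohomology ρ 1 :=
    Fin.append c (fun j => galoisCohomology.map θ' 1 (c' j))
  have hd : ∀ i, d i ≠ 0 := by
    intro i
    refine Fin.addCases (fun i => ?_) (fun j => ?_) i
    · simp only [d, Fin.append_left]
      exact hc i
    · simp only [d, Fin.append_right]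
      exact fun h => hc' j (hθ' (by rw [h, map_zero]))
  refine (infinite_setOf_mem_frobeniusClassPrimes_forall_localization_ne_zero ρ hN S hS hτ hirr hH3
    hn d hd).mono ?_
  rintro q ⟨hq, hloc⟩
  refine ⟨hq, fun i => ?_, fun j => fun h0 => ?_⟩
  · have h := hloc (Fin.castAdd n' i)
    simp only [d, Fin.append_left] at h
    exact h
  · have h := hloc (Fin.natAdd n j)
    simp only [d, Fin.append_right] at h
    apply h
    rw [CoreRankZero.localization_map_one_eq θ' (Sum.inr q) (c' j), h0]
    exact map_zero _

/-- **[MR04] Prop. 3.6.1 at every `p` under Sakamoto's hypotheses**: one class `c ∈ H¹(K, T̄)` and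
one class `c′ ∈ H¹(K, T̄′)` (`T̄′ → T̄` equivariant, injective on `H¹`), both non-zero ⟹ infinitely
many `𝔮 ∈ frobeniusClassPrimes ρ S τ N` with `loc_𝔮 c ≠ 0 ∧ loc_𝔮 c′ ≠ 0` (`1 + 1 ≤ p`).
[cite: MazurRubin2004, Prop. 3.6.1 (pp. 30–31)] [cite: Sakamoto2024, Cor. 5.5 (p. 929)] -/
theorem infinite_setOf_mem_frobeniusClassPrimes_localization_ne_zero_dual
    {p : ℕ} [Fact p.Prime] {N : ℕ} (hN : N ≠ 0)
    (S : Set (HeightOneSpectrum (𝓞 K))) (hS : S.Finite)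
    {τ : absoluteGaloisGroup K} (hτ : Nonempty (cokerSubOne ρ τ ≃+ ZMod p))
    (hirr : ∀ A : AddSubgroup M,
      (∀ (s : absoluteGaloisGroup K), ∀ m ∈ A, ρ s m ∈ A) → A = ⊥ ∨ A = ⊤)
    (hH3 : ∀ f : contOneCocycles ρ.toTopRep,
      (∀ u : absoluteGaloisGroup K, ρ u = 1 → u ∈ rootsOfUnityFixer K N → f.1 u = 0) →
        oneCocycleClass ρ.toTopRep f = 0)
    (θ' : ρ'.toContRepresentation →ⁱL ρ.toContRepresentation)
    (hθ' : Injective (galoisCohomology.map θ' 1))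
    (c : galoisCohomology ρ 1) (hc : c ≠ 0) (c' : galoisCohomology ρ' 1) (hc' : c' ≠ 0) :
    {q | q ∈ frobeniusClassPrimes ρ S τ N ∧ galoisCohomology.localization ρ (Sum.inr q) 1 c ≠ 0 ∧
      galoisCohomology.localization ρ' (Sum.inr q) 1 c' ≠ 0}.Infinite := by
  have hp : 1 + 1 ≤ p := (Fact.out : p.Prime).two_le
  refine (infinite_setOf_mem_frobeniusClassPrimes_localization_ne_zero_mixed ρ hN S hS hτ hirr hH3 θ'
    hθ' hp ![c] (fun i => by fin_cases i; exact hc) ![c'] (fun j => by fin_cases j; exact hc')).mono ?_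
  rintro q ⟨hq, h, h'⟩
  exact ⟨hq, h 0, h' 0⟩

end Generic

/-! ### The `E[p]` reading over `ℚ`: the dual class lives in `H¹(ℚ, E[p]^D)` -/

section Torsion

variable (W : WeierstrassCurve ℚ) [W.IsElliptic]

/-- **[MR04] Prop. 3.6.1 for `T̄ = E[p]`, `p` odd, `ρ̄_{E,p}` onto, with Sakamoto's primes** — for
non-zero `c ∈ H¹(ℚ, E[p])` and `c* ∈ H¹(ℚ, E[p]^D)` (`E[p]^D = Hom(E[p], μ_p)`, the tree's `tateDual`),
any finite `S`, any `τ` with `E[p]/(τ − 1) ≃ ℤ/p`: infinitely many `𝔮 ∈ frobeniusClassPrimes (E[p]) S τ p`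
have `loc_𝔮 c ≠ 0 ∧ loc_𝔮 c* ≠ 0`.  The dual class is transported by the inverse Weil transport
`X11b.LocBridge.weilDualInv` (injective on `H¹`: `map_weilDual_map_weilDualInv`); (H.1)/(H.3) from
surjectivity as in `…_torsion`; `[Finite E[p]]` is a binder because the Tate dual's statement needs it
(a theorem: `finite_torsionPoints_holds`).  The input of [MR04] Lemma 4.1.9 / Prop. 4.3.10 /
Thm. 4.3.12 at `p = 3`.
[cite: MazurRubin2004, Prop. 3.6.1 (pp. 30–31) and Lemma 4.1.9] [cite: Sakamoto2024, Cor. 5.5 (p. 929)]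
[cite: MilneADT2006, Ch. I §6, proof of Prop. 6.9] -/
theorem infinite_setOf_mem_frobeniusClassPrimes_localization_ne_zero_torsion_dual
    (p : ℕ) [Fact p.Prime] [Finite (geomTorsion W (p : ℤ))] (hp2 : p ≠ 2)
    (hsurj : W.HasSurjectiveModNGaloisRep (p : ℤ))
    (S : Set (HeightOneSpectrum (𝓞 ℚ))) (hS : S.Finite) {τ : absoluteGaloisGroup ℚ}
    (hτ : Nonempty (cokerSubOne (W.torsionGaloisModule (p : ℤ)) τ ≃+ ZMod p))
    (c : galoisCohomology (W.torsionGaloisModule (p : ℤ)) 1) (hc : c ≠ 0)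
    (c' : galoisCohomology ((W.torsionGaloisModule (p : ℤ)).tateDual p) 1) (hc' : c' ≠ 0) :
    {q | q ∈ frobeniusClassPrimes (W.torsionGaloisModule (p : ℤ)) S τ p ∧
      galoisCohomology.localization (W.torsionGaloisModule (p : ℤ)) (Sum.inr q) 1 c ≠ 0 ∧
      galoisCohomology.localization ((W.torsionGaloisModule (p : ℤ)).tateDual p) (Sum.inr q) 1 c'
        ≠ 0}.Infinite := by
  have hp : p.Prime := Fact.out
  haveI : NeZero p := ⟨hp.ne_zero⟩
  haveI : NeZero (p : ℚ) := ⟨Nat.cast_ne_zero.mpr hp.ne_zero⟩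
  obtain ⟨e, hμ, hadd₁, hadd₂, -, hnondeg, hgal⟩ :=
    exists_weilPairing_holds W p hp.two_le (Nat.cast_ne_zero.2 hp.ne_zero)
  have hirr := hasIrreducibleModPGaloisRep_of_hasSurjectiveModNGaloisRep W p hsurj
  refine infinite_setOf_mem_frobeniusClassPrimes_localization_ne_zero_dual
    (W.torsionGaloisModule (p : ℤ)) hp.ne_zero S hS hτ (fun A hA => hirr A fun σ P hP => hA σ P hP)
    (fun f hf => hH3_self_of_hasSurjectiveModNGaloisRep W p hp2 hsurj f hf)
    (weilDualInv W p e hμ hadd₁ hadd₂ hgal hnondeg) ?_ c hc c' hc'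
  intro y y' h
  have h' := congrArg (galoisCohomology.map (weilDualIntertwining W p e hμ hadd₁ hadd₂ hgal) 1) h
  rwa [map_weilDual_map_weilDualInv, map_weilDual_map_weilDualInv] at h'

/-- **Two classes and a dual class** (`p` odd, so `2 + 1 ≤ p`): for non-zero `c₁, c₂ ∈ H¹(ℚ, E[p])`
and `c* ∈ H¹(ℚ, E[p]^D)`, infinitely many `𝔮 ∈ frobeniusClassPrimes (E[p]) S τ p` have
`loc_𝔮 c₁ ≠ 0 ∧ loc_𝔮 c₂ ≠ 0 ∧ loc_𝔮 c* ≠ 0` — the shape used when an edge of `𝒳⁰` must avoid two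
given classes at once ([MR04] §4.3). [cite: MazurRubin2004, Prop. 3.6.1 (pp. 30–31) and Prop. 4.3.10]
[cite: Sakamoto2024, Cor. 5.5 (p. 929)] -/
theorem infinite_setOf_mem_frobeniusClassPrimes_localization_ne_zero_torsion_mixed
    (p : ℕ) [Fact p.Prime] [Finite (geomTorsion W (p : ℤ))] (hp2 : p ≠ 2)
    (hsurj : W.HasSurjectiveModNGaloisRep (p : ℤ))
    (S : Set (HeightOneSpectrum (𝓞 ℚ))) (hS : S.Finite) {τ : absoluteGaloisGroup ℚ}
    (hτ : Nonempty (cokerSubOne (W.torsionGaloisModule (p : ℤ)) τ ≃+ ZMod p))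
    (c₁ c₂ : galoisCohomology (W.torsionGaloisModule (p : ℤ)) 1) (hc₁ : c₁ ≠ 0) (hc₂ : c₂ ≠ 0)
    (c' : galoisCohomology ((W.torsionGaloisModule (p : ℤ)).tateDual p) 1) (hc' : c' ≠ 0) :
    {q | q ∈ frobeniusClassPrimes (W.torsionGaloisModule (p : ℤ)) S τ p ∧
      galoisCohomology.localization (W.torsionGaloisModule (p : ℤ)) (Sum.inr q) 1 c₁ ≠ 0 ∧
      galoisCohomology.localization (W.torsionGaloisModule (p : ℤ)) (Sum.inr q) 1 c₂ ≠ 0 ∧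
      galoisCohomology.localization ((W.torsionGaloisModule (p : ℤ)).tateDual p) (Sum.inr q) 1 c'
        ≠ 0}.Infinite := by
  have hp : p.Prime := Fact.out
  haveI : NeZero p := ⟨hp.ne_zero⟩
  haveI : NeZero (p : ℚ) := ⟨Nat.cast_ne_zero.mpr hp.ne_zero⟩
  have hp3 : 2 + 1 ≤ p := by
    rcases hp.eq_two_or_odd' with h | h
    · exact absurd h hp2
    · have := hp.two_le; omega
  obtain ⟨e, hμ, hadd₁, hadd₂, -, hnondeg, hgal⟩ :=
    exists_weilPairing_holds W p hp.two_le (Nat.cast_ne_zero.2 hp.ne_zero)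
  have hirr := hasIrreducibleModPGaloisRep_of_hasSurjectiveModNGaloisRep W p hsurj
  have hinj : Injective (galoisCohomology.map (weilDualInv W p e hμ hadd₁ hadd₂ hgal hnondeg) 1) := by
    intro y y' h
    have h' := congrArg (galoisCohomology.map (weilDualIntertwining W p e hμ hadd₁ hadd₂ hgal) 1) h
    rwa [map_weilDual_map_weilDualInv, map_weilDual_map_weilDualInv] at h'
  refine (infinite_setOf_mem_frobeniusClassPrimes_localization_ne_zero_mixed
    (W.torsionGaloisModule (p : ℤ)) hp.ne_zero S hS hτ (fun A hA => hirr A fun σ P hP => hA σ P hP)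
    (fun f hf => hH3_self_of_hasSurjectiveModNGaloisRep W p hp2 hsurj f hf)
    (weilDualInv W p e hμ hadd₁ hadd₂ hgal hnondeg) hinj hp3 ![c₁, c₂]
    (fun i => by fin_cases i <;> assumption) ![c'] (fun j => by fin_cases j; exact hc')).mono ?_
  rintro q ⟨hq, h, h'⟩
  exact ⟨hq, h 0, h 1, h' 0⟩

end Torsion

end Summit.BirchSwinnertonDyer.Rank1Residual.GaloisImage.PrimeChoice

end
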